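import Summits.Ventures.QEC.Thresholds.ToricCodeThresholds
import Summits.Ventures.QEC.Thresholds.ToricCodeThresholdMemoryFour
import Summits.Ventures.QEC.Thresholds.ToricCodeClusterThreshold
import Literature.InformationTheory.QuantumCodes.ToricCodeThresholdProof
import Literature.InformationTheory.QuantumCodes.IIDBitFlip
import HarnessLib

/-!
# Toric-code thresholds under minimum-weight decoding — the UNCONDITIONAL theorems
# (LADDER-QEC Q5, certified column, tier CERTIFIED/kernel)

Venture QEC, `Summits/Ventures/QEC/Thresholds/` (director-qec D4″ and 2026-08-26T21:01:06Z (4):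
"file the unconditional corollary when [the cycle-weight fact] is discharged"; qec-lead FINDINGS
row Q5-1). HONEST FRAMING: the instance files `ToricCodeThresholds.lean`,
`ToricCodeThresholdMemoryFour.lean` (self-avoiding-polygon route, Dennis–Kitaev–Landahl–Preskill)
and `ToricCodeClusterThreshold.lean` (cluster-counting route, Kovalev–Pryadko / Gottesman) took
as explicit hypotheses the named facts `ToricCode.toricThreshold_of_sawCountBound` resp.
`ToricCode.cycle_weight_ge` of `Literature/…/ToricCodeThreshold.lean`. Both facts are now PROVED
in the tree (qec-lit-2: `ToricCode.toricThreshold_of_sawCountBound_holds`,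
`ToricCode.failureProb_le_of_sawCountBound_holds` in `ToricCodeThresholdProof.lean`;
`ToricCode.cycle_weight_ge_holds` in `ToricCodeCycles.lean`), so this file discharges the
hypotheses BY IMPORT and records the resulting theorems WITHOUT any named-fact hypothesis and
without `native_decide` (axioms `propext`, `Classical.choice`, `Quot.sound` only):

| theorem | statement | route / walk-count input | value |
|---|---|---|---|
| `toricThreshold_sawCountBound` | `cₙ ≤ C νⁿ` (`ν ≥ 1`) ⟹ `p₀(ν)` is a threshold lower bound | DKLP, parametric | `p₀(ν) = (1-√(1-ν⁻²))/2` |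
| `toricThreshold_three` | threshold `≥ p₀(3)` | DKLP, `SAW.Zd.count_succ_le` | `(3-2√2)/6 ≈ .02860` |
| `toricThreshold_nuMemFour` | threshold `≥ p₀(26^{1/3})` | DKLP, `SAW.Zd.count_le_two_mul_mul_memFourConst_pow` | `> .0293` |
| `toricThreshold_connectiveConstant_le` | any proved `μ(ℤ²) ≤ μ'` ⟹ threshold `≥ p₀(μ')` | DKLP, `SAW.Zd.tendsto_count_rpow` | `p₀(μ')` |
| `toricThreshold_PT2000_of_bounds` | threshold `≥ p₀(2.679193) > .0361` | DKLP; CONDITIONAL on the named fact `SAW.Zd.BDGS2012_connectiveConstant_two_bounds` ONLY | `> .0361` |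
| `toricThreshold_cluster` | threshold `≥ 1/(4·6⁴)` | cluster counting, degree `Δ = 6` | `1/5184` |
| `toric_failureProb_le_three` | finite size: `Prob_fail ≤ (8/9) L² (6s)^L/(1-6s)`, `s = √(p(1-p))`, `L ≥ 3` | DKLP eq. (fail_2d) | — |

for EVERY family of minimum-weight decoders (`Decoder.IsMinWeight` w.r.t. the star syndrome, the
cycles and the Hamming weight), under independent bit-flip (`Z`) noise with perfect syndrome
measurement; plus the same bounds for the accuracy threshold `p_c` (`accuracyThreshold`), the
statements in the `PMF` vocabulary of PARTITION row 09 (`Decoder.logicalFailureProb`,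
`HasThreshold`, via `IIDBitFlip.lean`), and — so that nothing is vacuous — the canonical
minimum-weight decoders `Decoder.minWeight (syn L) hammingNorm` (type-08) with their instances
(`ToricCode.isMinWeight_minWeight`, `ToricCode.accuracyThreshold_minWeight_gt`,
`ToricCode.hasThreshold_minWeight`). Theorem-only file (no definitions, no named facts). Best kernel-tier decimal: `p_c > .0293`; with the Pönitz–Tittmann named fact: `> .0361`;
the CHECKED-native value `.0358` (`ToricCodeThresholdNative.lean`, `native_decide`) is kept out of
this file. NOT A THEOREM ANYWHERE: DKLP's printed `p_c ≥ .0373` (numerical `μ₂ ≈ 2.638`, CLAIM).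
No Monte Carlo number appears here (VALIDATED column = `bench/VALIDATED.tsv`).

## References

* [DennisEtAl2002] E. Dennis, A. Kitaev, A. Landahl, J. Preskill, *Topological quantum memory*,
  J. Math. Phys. 43 (2002) 4452–4505, arXiv:quant-ph/0110143, §4.3 (threshold), §5.2–5.3
  eqs. (saw_d), (saw_2), (threshold_2d)–(p_c_2d), (fail_2d).
* [Gottesman2014] D. Gottesman, *Fault-tolerant quantum computation with constant overhead*,
  Quantum Inf. Comput. 14 (2014) 1338, §4 Thm. 3.
* [KovalevPryadko2013] A. A. Kovalev, L. P. Pryadko, Phys. Rev. A 87 (2013) 020304(R), Thm. 3.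
* [BDGS2012] Bauerschmidt–Duminil-Copin–Goodman–Slade, *Lectures on self-avoiding walks*, §1.3
  eqs. (1.13)–(1.14).
-/

noncomputable section

namespace Summit.Ventures.QEC.Thresholds

open Filter Topology Finset Matrix
open scoped ENNReal NNReal
open Literature.InformationTheory.QuantumCodes
open Literature.InformationTheory.QuantumCodes.ToricCode
open Literature.Probability.RandomPlanarGeometry

/-! ### Route 1 (Dennis–Kitaev–Landahl–Preskill, self-avoiding polygons): unconditional -/

/-- **The D4″ parametric threshold theorem, unconditional**: if `cₙ ≤ C νⁿ` for all `n`
(`ν ≥ 1`; `cₙ` = number of `n`-step self-avoiding walks on `ℤ²`), then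
`p₀(ν) = (1 - √(1 - ν⁻²))/2` is a lower bound on the accuracy threshold of every minimum-weight
decoder family of the toric codes under independent bit-flip noise with perfect syndrome
measurement. tier CERTIFIED (kernel), no named-fact hypothesis.
[cite: DennisEtAl2002, §5.3 eqs. (threshold_2d)–(p_c_2d)] -/
theorem toricThreshold_sawCountBound {C ν : ℝ} (hν : 1 ≤ ν) (hc : SAWCountBound C ν)
    {D : (L : ℕ) → ZDecoder (L + 1)}
    (hD : ∀ L, (D L).IsMinWeight (syn (L + 1)) (cycles (L + 1)) hammingNorm) :
    IsThresholdLowerBound (toricFailureFamily D) (thresholdValue ν) :=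
  isThresholdLowerBound_of_sawCountBound toricThreshold_of_sawCountBound_holds hν hc hD

/-- Limit form, unconditional: if for EVERY `ν > μ'` (`μ' ≥ 1`) some `C` has `cₙ ≤ C νⁿ`, then
`p₀(μ')` is a threshold lower bound for every minimum-weight decoder family.
[cite: DennisEtAl2002, §5.3 eq. (threshold_2d)] -/
theorem toricThreshold_forall_gt {μ' : ℝ} (hμ' : 1 ≤ μ')
    (hc : ∀ ν : ℝ, μ' < ν → ∃ C : ℝ, SAWCountBound C ν)
    {D : (L : ℕ) → ZDecoder (L + 1)}
    (hD : ∀ L, (D L).IsMinWeight (syn (L + 1)) (cycles (L + 1)) hammingNorm) :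
    IsThresholdLowerBound (toricFailureFamily D) (thresholdValue μ') :=
  isThresholdLowerBound_of_forall_gt toricThreshold_of_sawCountBound_holds hμ' hc hD

/-- **Threshold from any bound on the connective constant, unconditional in the toric-code
input**: if `μ(ℤ²) ≤ μ'` (`μ' ≥ 1`) then `p₀(μ')` is a threshold lower bound for every
minimum-weight decoder family (the tier is that of the bound `μ ≤ μ'` supplied).
[cite: DennisEtAl2002, §5.3 eqs. (saw_2), (threshold_2d)] -/
theorem toricThreshold_connectiveConstant_le {μ' : ℝ} (hμ'1 : 1 ≤ μ')
    (hμ : SAW.Zd.connectiveConstant 2 ≤ μ') {D : (L : ℕ) → ZDecoder (L + 1)}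
    (hD : ∀ L, (D L).IsMinWeight (syn (L + 1)) (cycles (L + 1)) hammingNorm) :
    IsThresholdLowerBound (toricFailureFamily D) (thresholdValue μ') :=
  toricThreshold_of_connectiveConstant_le toricThreshold_of_sawCountBound_holds hμ'1 hμ hD

/-- **Toric-code threshold `≥ (3 - 2√2)/6 ≈ .0286`, unconditional** (DKLP's elementary walk count
`cₙ ≤ 4·3ⁿ⁻¹`): for every minimum-weight decoder family. tier CERTIFIED (kernel).
[cite: DennisEtAl2002, §5.3 eqs. (saw_d), (threshold_2d)] -/
theorem toricThreshold_three {D : (L : ℕ) → ZDecoder (L + 1)}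
    (hD : ∀ L, (D L).IsMinWeight (syn (L + 1)) (cycles (L + 1)) hammingNorm) :
    IsThresholdLowerBound (toricFailureFamily D) ((3 - 2 * Real.sqrt 2) / 6) := by
  rw [← thresholdValue_three]
  exact toricThreshold_elementary toricThreshold_of_sawCountBound_holds hD

/-- **Toric-code threshold `≥ p₀(26^{1/3}) > .0293`, unconditional** (the tree's kernel-checked
memory-4 walk count `c_{3m+1} ≤ 4·26^m`): for every minimum-weight decoder family — the best
kernel-tier value. tier CERTIFIED (kernel). [cite: DennisEtAl2002, §5.3 eq. (threshold_2d)] -/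
theorem toricThreshold_nuMemFour {D : (L : ℕ) → ZDecoder (L + 1)}
    (hD : ∀ L, (D L).IsMinWeight (syn (L + 1)) (cycles (L + 1)) hammingNorm) :
    IsThresholdLowerBound (toricFailureFamily D) (thresholdValue nuMemFour) :=
  toricThreshold_memoryFour toricThreshold_of_sawCountBound_holds hD

/-- Decimal form: **every `0 ≤ p < .0293` is below threshold** for every minimum-weight decoder
family of the toric codes (failure probability `→ 0` as `L → ∞`). tier CERTIFIED (kernel).
[cite: DennisEtAl2002, §4.3 (below threshold) and §5.3 eq. (threshold_2d)] -/
theorem toricThreshold_0293 {D : (L : ℕ) → ZDecoder (L + 1)}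
    (hD : ∀ L, (D L).IsMinWeight (syn (L + 1)) (cycles (L + 1)) hammingNorm) :
    IsThresholdLowerBound (toricFailureFamily D) 0.0293 :=
  (toricThreshold_nuMemFour hD).anti thresholdValue_nuMemFour_gt.le

/-- **Pönitz–Tittmann instance, conditional ONLY on the connective-constant fact**: granted
`SAW.Zd.BDGS2012_connectiveConstant_two_bounds` (`μ(ℤ²) ≤ 2.679193`, BDGS2012 eq. (1.14)),
`p₀(2.679193) > .0361` is a threshold lower bound for every minimum-weight decoder family.
tier CERTIFIED-conditional (on that one Literature fact; the toric-code side is proved).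
[cite: DennisEtAl2002, §5.3 eqs. (saw_2), (p_c_2d)] -/
theorem toricThreshold_PT2000_of_bounds (hμ : SAW.Zd.BDGS2012_connectiveConstant_two_bounds)
    {D : (L : ℕ) → ZDecoder (L + 1)}
    (hD : ∀ L, (D L).IsMinWeight (syn (L + 1)) (cycles (L + 1)) hammingNorm) :
    IsThresholdLowerBound (toricFailureFamily D) (thresholdValue 2.679193) :=
  toricThreshold_PT2000 toricThreshold_of_sawCountBound_holds hμ hD

/-! ### Route 2 (Kovalev–Pryadko / Gottesman cluster counting): unconditional -/

/-- **Toric-code threshold `≥ 1/(4·6⁴) = 1/5184` by the cluster route, unconditional**: for every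
minimum-weight decoder family; the only input beyond the generic cluster-counting bound is
`d_Z ≥ L`, now the theorem `ToricCode.cycle_weight_ge_holds`. tier CERTIFIED (kernel).
[cite: Gottesman2014, Thm 3 (p₀ = (2ze)^{-2}, here (2Δ²)^{-2} with Δ = 6)] -/
theorem toricThreshold_cluster {D : (L : ℕ) → ZDecoder (L + 1)}
    (hD : ∀ L, (D L).IsMinWeight (syn (L + 1)) (cycles (L + 1)) hammingNorm) :
    IsThresholdLowerBound (toricFailureFamily D) (1 / (4 * (6 : ℝ) ^ 4)) :=
  ToricCluster.toricThreshold_clusterRoute cycle_weight_ge_holds hD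

/-- Finite-size bound of the cluster route, unconditional: for a minimum-weight decoder of the
`L × L` toric code (`L ≥ 1`), `0 ≤ p ≤ 1` and `r := 72√p < 1`, `Prob_fail ≤ 2L² r^L/(36(1-r))`.
[cite: Gottesman2014, Thm 3 (n (p/p₀)^{d/2} shape)] -/
theorem toric_failureProb_le_cluster (L : ℕ) [NeZero L] (hL1 : 1 ≤ L) {D : ZDecoder L}
    (hD : D.IsMinWeight (syn L) (cycles L) hammingNorm) {p : ℝ} (hp₀ : 0 ≤ p) (hp₁ : p ≤ 1)
    (hr : 2 * (6 : ℝ) ^ 2 * Real.sqrt p < 1) :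
    failureProb L D p ≤ (2 * (L : ℝ) ^ 2) * (2 * (6 : ℝ) ^ 2 * Real.sqrt p) ^ L /
      ((6 : ℝ) ^ 2 * (1 - 2 * (6 : ℝ) ^ 2 * Real.sqrt p)) :=
  ToricCluster.failureProb_le_cluster cycle_weight_ge_holds L hL1 hD hp₀ hp₁ hr

/-! ### Finite-size bounds of Route 1, unconditional -/

/-- **DKLP's finite-size bound, unconditional and parametric**: under `cₙ ≤ C νⁿ` (`ν > 0`), for
`L ≥ 3`, a minimum-weight decoder, `0 ≤ p ≤ 1/2` and `r := 2ν√(p(1-p)) < 1`,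
`Prob_fail ≤ 2L² C r^L/(ν(1-r))`. tier CERTIFIED (kernel). [cite: DennisEtAl2002, §5.3 eq. (fail_2d)] -/
theorem toric_failureProb_le {C ν : ℝ} (hν : 0 < ν) (hc : SAWCountBound C ν) (L : ℕ) [NeZero L]
    (hL : 3 ≤ L) {D : ZDecoder L} (hD : D.IsMinWeight (syn L) (cycles L) hammingNorm) {p : ℝ}
    (hp₀ : 0 ≤ p) (hp : p ≤ 1 / 2) (hr : 2 * ν * Real.sqrt (p * (1 - p)) < 1) :
    failureProb L D p ≤ 2 * (L : ℝ) ^ 2 * C * (2 * ν * Real.sqrt (p * (1 - p))) ^ L /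
      (ν * (1 - 2 * ν * Real.sqrt (p * (1 - p)))) :=
  failureProb_le_of_sawCountBound_holds C ν hν hc L hL D hD p hp₀ hp hr

/-- **Explicit finite-size bound at DKLP's elementary count** (`C = 4/3`, `ν = 3`): for `L ≥ 3`, a
minimum-weight decoder, `0 ≤ p ≤ 1/2` and `s := √(p(1-p))` with `6s < 1`,
`Prob_fail ≤ (8/9) · L² · (6s)^L / (1 - 6s)` — exponential decay in `L` for every
`p < (3 - 2√2)/6`. tier CERTIFIED (kernel). [cite: DennisEtAl2002, §5.3 eqs. (saw_d), (fail_2d)] -/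
theorem toric_failureProb_le_three (L : ℕ) [NeZero L] (hL : 3 ≤ L) {D : ZDecoder L}
    (hD : D.IsMinWeight (syn L) (cycles L) hammingNorm) {p : ℝ} (hp₀ : 0 ≤ p) (hp : p ≤ 1 / 2)
    (hs : 6 * Real.sqrt (p * (1 - p)) < 1) :
    failureProb L D p ≤ 8 / 9 * (L : ℝ) ^ 2 * (6 * Real.sqrt (p * (1 - p))) ^ L /
      (1 - 6 * Real.sqrt (p * (1 - p))) := by
  have hr : 2 * 3 * Real.sqrt (p * (1 - p)) < 1 := by linarith
  have h := toric_failureProb_le (C := 4 / 3) (ν := 3) (by norm_num) sawCountBound_three L hL hD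
    hp₀ hp hr
  have hne : 1 - 6 * Real.sqrt (p * (1 - p)) ≠ 0 := by linarith
  calc failureProb L D p
      ≤ 2 * (L : ℝ) ^ 2 * (4 / 3) * (2 * 3 * Real.sqrt (p * (1 - p))) ^ L /
          (3 * (1 - 2 * 3 * Real.sqrt (p * (1 - p)))) := h
    _ = 8 / 9 * (L : ℝ) ^ 2 * (6 * Real.sqrt (p * (1 - p))) ^ L /
          (1 - 6 * Real.sqrt (p * (1 - p))) := by
        rw [show (2 : ℝ) * 3 = 6 by norm_num]
        field_simp
        ring

/-! ### The accuracy threshold `p_c` -/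

/-- **`p_c ≥ p₀(ν)` under `cₙ ≤ C νⁿ`, unconditional.**
[cite: DennisEtAl2002, §5.3 (lower bound on the accuracy threshold)] -/
theorem thresholdValue_le_accuracyThreshold' {C ν : ℝ} (hν : 1 ≤ ν) (hc : SAWCountBound C ν)
    {D : (L : ℕ) → ZDecoder (L + 1)}
    (hD : ∀ L, (D L).IsMinWeight (syn (L + 1)) (cycles (L + 1)) hammingNorm) :
    thresholdValue ν ≤ accuracyThreshold (toricFailureFamily D) :=
  thresholdValue_le_accuracyThreshold toricThreshold_of_sawCountBound_holds hν hc hD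

/-- **`p_c ≥ (3 - 2√2)/6 ≈ .0286`, unconditional**, for every minimum-weight decoder family of the
toric codes under independent bit flips with perfect measurement. tier CERTIFIED (kernel).
[cite: DennisEtAl2002, §5.3 eqs. (saw_d), (p_c_2d)] -/
theorem accuracyThreshold_ge_three {D : (L : ℕ) → ZDecoder (L + 1)}
    (hD : ∀ L, (D L).IsMinWeight (syn (L + 1)) (cycles (L + 1)) hammingNorm) :
    (3 - 2 * Real.sqrt 2) / 6 ≤ accuracyThreshold (toricFailureFamily D) :=
  accuracyThreshold_ge_elementary toricThreshold_of_sawCountBound_holds hD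

/-- **`p_c > .0293`, unconditional** (memory-4 walk count), for every minimum-weight decoder family
— the best kernel-tier decimal in the tree. tier CERTIFIED (kernel).
[cite: DennisEtAl2002, §5.3 eq. (p_c_2d)] -/
theorem accuracyThreshold_gt_0293 {D : (L : ℕ) → ZDecoder (L + 1)}
    (hD : ∀ L, (D L).IsMinWeight (syn (L + 1)) (cycles (L + 1)) hammingNorm) :
    (0.0293 : ℝ) < accuracyThreshold (toricFailureFamily D) :=
  lt_of_lt_of_le thresholdValue_nuMemFour_gt
    (le_accuracyThreshold (toricThreshold_nuMemFour hD)
      ((thresholdValue_le_half _).trans (by norm_num)))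

/-- **`p_c ≥ 1/5184` by the cluster route, unconditional** (weaker than the DKLP values; recorded
as the independent second route). tier CERTIFIED (kernel). [cite: Gottesman2014, Thm 3] -/
theorem accuracyThreshold_ge_cluster {D : (L : ℕ) → ZDecoder (L + 1)}
    (hD : ∀ L, (D L).IsMinWeight (syn (L + 1)) (cycles (L + 1)) hammingNorm) :
    (1 / 5184 : ℝ) ≤ accuracyThreshold (toricFailureFamily D) := by
  rw [← ToricCluster.one_div_four_mul_six_pow_four]
  exact le_accuracyThreshold (toricThreshold_cluster hD) (by norm_num)

/-- **`p_c > .0361` granted the Pönitz–Tittmann fact** `SAW.Zd.BDGS2012_connectiveConstant_two_bounds`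
(tier CERTIFIED-conditional on that one Literature fact). [cite: DennisEtAl2002, §5.3 eqs. (saw_2), (p_c_2d)] -/
theorem accuracyThreshold_gt_0361_of_bounds (hμ : SAW.Zd.BDGS2012_connectiveConstant_two_bounds)
    {D : (L : ℕ) → ZDecoder (L + 1)}
    (hD : ∀ L, (D L).IsMinWeight (syn (L + 1)) (cycles (L + 1)) hammingNorm) :
    (0.0361 : ℝ) < accuracyThreshold (toricFailureFamily D) :=
  accuracyThreshold_gt_PT2000 toricThreshold_of_sawCountBound_holds hμ hD

/-! ### The canonical minimum-weight decoders (nothing above is vacuous) -/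

/-- **Minimum-weight decoders of the toric code exist**: type-08's canonical `Decoder.minWeight`
(on each observed star syndrome return a `Z`-chain of least Hamming weight with that boundary;
which minimiser is immaterial — "If the minimal chain is not unique, one of the minimal chains is
selected") is a minimum-weight decoder in the sense of `Decoder.IsMinWeight` for the star
syndrome, the cycles and the Hamming weight (equal syndromes ⟺ the difference is a cycle; the
weight is negation-invariant). Noncomputable specification, not an algorithm.
[cite: DennisEtAl2002, §5.2 (E_min has the same boundary as E and minimal length)] -/
theorem ToricCode.isMinWeight_minWeight (L : ℕ) [NeZero L] :
    (Decoder.minWeight (syn L) hammingNorm).IsMinWeight (syn L) (cycles L) hammingNorm := by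
  refine Decoder.isMinWeight_minWeight _ _ _ (fun y z h => ?_) (fun x => ?_)
  · show starMatrix L *ᵥ (y - z) = 0
    rw [Matrix.mulVec_sub]
    change syn L y - syn L z = 0
    rw [h, sub_self]
  · rw [show -x = x from funext fun i => ZMod.neg_eq_self_mod_two (x i)]

/-- **The canonical minimum-weight decoding of the toric codes has accuracy threshold `> .0293`**
under independent bit flips with perfect syndrome measurement, unconditionally. tier CERTIFIED
(kernel). [cite: DennisEtAl2002, §5.3 eq. (p_c_2d)] -/
theorem ToricCode.accuracyThreshold_minWeight_gt :
    (0.0293 : ℝ) < accuracyThreshold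
      (toricFailureFamily fun L => Decoder.minWeight (syn (L + 1)) hammingNorm) :=
  accuracyThreshold_gt_0293 fun L => ToricCode.isMinWeight_minWeight (L + 1)

/-- The canonical minimum-weight decoders are below threshold at every `0 ≤ p < p₀(26^{1/3})`.
[cite: DennisEtAl2002, §5.3 eq. (threshold_2d)] -/
theorem ToricCode.toricThreshold_minWeight :
    IsThresholdLowerBound (toricFailureFamily fun L => Decoder.minWeight (syn (L + 1)) hammingNorm)
      (thresholdValue nuMemFour) :=
  toricThreshold_nuMemFour fun L => ToricCode.isMinWeight_minWeight (L + 1)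

/-- The canonical minimum-weight decoders have threshold `≥ 1/5184` by the cluster route as well
(independent second proof). [cite: Gottesman2014, Thm 3] -/
theorem ToricCode.toricThreshold_minWeight_cluster :
    IsThresholdLowerBound (toricFailureFamily fun L => Decoder.minWeight (syn (L + 1)) hammingNorm)
      (1 / (4 * (6 : ℝ) ^ 4)) :=
  toricThreshold_cluster fun L => ToricCode.isMinWeight_minWeight (L + 1)

/-! ### The same theorems in the `PMF` vocabulary of row 09 (`logicalFailureProb`, `HasThreshold`)

The failure family as genuine probabilities is `fun L p => (D L).logicalFailureProb (syn (L+1))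
(boundaries (L+1)) (iidLaw (bitLaw (min p.toNNReal 1) _))` — the `PMF`-valued logical failure
probability (`LogicalFailure.lean`) under the product bit-flip law of rate `p` (`IIDBitFlip.lean`;
rates outside `[0,1]` are clamped and never consulted: the threshold notions quantify over
`0 ≤ p < p₀ ≤ 1`). This is the usage prescribed in the docstring of `HasThreshold`. -/

/-- For `0 ≤ p ≤ 1` the `PMF`-valued failure probability under `iidLaw (bitLaw p)`, read in `ℝ`,
is the finite sum `failureProb` ("one number, two vocabularies",
`ToricCode.failureProb_eq_toReal_logicalFailureProb`). [cite: DennisEtAl2002, §4.3 eq. (ec_cond)] -/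
theorem toReal_logicalFailureProb_bitFlip (L : ℕ) [NeZero L] (D : ZDecoder L) {p : ℝ}
    (hp₀ : 0 ≤ p) (hp₁ : p ≤ 1) :
    (D.logicalFailureProb (syn L) (boundaries L)
        (iidLaw (bitLaw (min p.toNNReal 1) (min_le_right _ _)))).toReal = failureProb L D p := by
  have hmin : (((min p.toNNReal 1 : ℝ≥0)) : ℝ) = p := by
    rw [min_eq_left (Real.toNNReal_le_one.2 hp₁), Real.coe_toNNReal _ hp₀]
  rw [← failureProb_eq_toReal_logicalFailureProb, hmin]

/-- A real threshold lower bound `p₀ ≤ 1` for `toricFailureFamily D` is a threshold of the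
`PMF` family in the sense of `HasThreshold`. [cite: DennisEtAl2002, §4.3 (definition of the threshold)] -/
theorem hasThreshold_of_isThresholdLowerBound {D : (L : ℕ) → ZDecoder (L + 1)} {p₀ : ℝ}
    (h : IsThresholdLowerBound (toricFailureFamily D) p₀) (hp₀ : p₀ ≤ 1) :
    HasThreshold (fun L p => (D L).logicalFailureProb (syn (L + 1)) (boundaries (L + 1))
      (iidLaw (bitLaw (min p.toNNReal 1) (min_le_right _ _)))) p₀ := by
  refine (hasThreshold_iff_isThresholdLowerBound_toReal
    (P := fun L p => (D L).logicalFailureProb (syn (L + 1)) (boundaries (L + 1))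
      (iidLaw (bitLaw (min p.toNNReal 1) (min_le_right _ _))))
    (fun L p => ne_top_of_le_ne_top ENNReal.one_ne_top (Decoder.logicalFailureProb_le_one _ _ _ _))
    p₀).2 ?_
  intro p hp hpp
  have h1 : p ≤ 1 := hpp.le.trans hp₀
  exact (h p hp hpp).congr fun L => (toReal_logicalFailureProb_bitFlip (L + 1) (D L) hp h1).symm

/-- **Row-09 headline in the PARTITION's vocabulary** (`HasThreshold family decoder pth`): for
every minimum-weight decoder family `D` of the toric codes, the logical failure probability under
i.i.d. bit flips of rate `p` tends to `0` as `L → ∞` for every `0 ≤ p < p₀(26^{1/3})` (`> .0293`).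
Unconditional; tier CERTIFIED (kernel). [cite: DennisEtAl2002, §4.3 and §5.3 eq. (threshold_2d)] -/
theorem hasThreshold_toric_nuMemFour {D : (L : ℕ) → ZDecoder (L + 1)}
    (hD : ∀ L, (D L).IsMinWeight (syn (L + 1)) (cycles (L + 1)) hammingNorm) :
    HasThreshold (fun L p => (D L).logicalFailureProb (syn (L + 1)) (boundaries (L + 1))
      (iidLaw (bitLaw (min p.toNNReal 1) (min_le_right _ _)))) (thresholdValue nuMemFour) :=
  hasThreshold_of_isThresholdLowerBound (toricThreshold_nuMemFour hD)
    ((thresholdValue_le_half _).trans (by norm_num))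

/-- `HasThreshold` at the decimal `.0293` for every minimum-weight decoder family, unconditional.
[cite: DennisEtAl2002, §5.3 eq. (p_c_2d)] -/
theorem hasThreshold_toric_0293 {D : (L : ℕ) → ZDecoder (L + 1)}
    (hD : ∀ L, (D L).IsMinWeight (syn (L + 1)) (cycles (L + 1)) hammingNorm) :
    HasThreshold (fun L p => (D L).logicalFailureProb (syn (L + 1)) (boundaries (L + 1))
      (iidLaw (bitLaw (min p.toNNReal 1) (min_le_right _ _)))) 0.0293 :=
  hasThreshold_of_isThresholdLowerBound (toricThreshold_0293 hD) (by norm_num)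

/-- `HasThreshold` for the canonical minimum-weight decoders at `p₀(26^{1/3}) > .0293`,
unconditional — the DKLP toric-code threshold statement of PARTITION row 09 with every
hypothesis discharged. tier CERTIFIED (kernel). [cite: DennisEtAl2002, §5.3 eq. (threshold_2d)] -/
theorem ToricCode.hasThreshold_minWeight :
    HasThreshold (fun L p => (Decoder.minWeight (syn (L + 1)) hammingNorm).logicalFailureProb
      (syn (L + 1)) (boundaries (L + 1)) (iidLaw (bitLaw (min p.toNNReal 1) (min_le_right _ _))))
      (thresholdValue nuMemFour) :=
  hasThreshold_toric_nuMemFour fun L => ToricCode.isMinWeight_minWeight (L + 1)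

end Summit.Ventures.QEC.Thresholds

end
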